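import Mathlib
import HarnessLib
import Summits.KontsevichZagierPeriods.Zeta5Search.SorokinConvergence

/-!
# ζ(5) search — the corner conditions of `J_k` are open: a uniform perturbation room `η` (cell `pub-zeta5`, ct-1 g27)

HONEST FRAMING: systematic search; no irrationality claim unless kernel-certified.  Elementary real inequalities plus one application
of `SorokinConvergence.integrableOn_sorokinIntegrand`; nothing here is an irrationality result, a worthiness exponent or a denominator
statement; no named fact is discharged; no definition is introduced.

`SorokinParameterHolomorphy.hasDerivAt_line` (holomorphy of the complex-parameter `J_k` along a line of parameters) asks for the
integrability of the typed real integrand at the PERTURBED real parts `(a₀ + η; a_j − η | b_j − 2η)` for some `η > 0`.  Since the edge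
and corner conditions of `integrableOn_sorokinIntegrand` are finitely many STRICT linear inequalities, such an `η` always exists:

* `exists_perturb` — from the conditions at `(a₀; a | b)` an `η > 0` at which they still hold for `(a₀ + η; a_j − η | b_j − 2η)`;
* `exists_integrable_perturb` — hence `∃ η > 0`, the typed integrand at the perturbed parameters is integrable on `[0,1]^k`
  (the hypothesis `hJη` of `hasDerivAt_line`, discharged from the corner conditions alone).

Theorems only; imports `Zeta5Search/SorokinConvergence`.
-/

noncomputable section

namespace Summit.KontsevichZagierPeriods.Zeta5Search.SorokinCornerPerturb

open MeasureTheory Set Finset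
open Literature.NumberTheory.Irrationality.Zudilin2002 (sorokinIntegrand)
open Summit.KontsevichZagierPeriods.Zeta5Search.SorokinConvergence

/-- The perturbed chain sum: `Σ_{m≤i}((b_{2m} − 2η) − (a_{2m} − η)) = Σ_{m≤i}(b_{2m} − a_{2m}) − (i+1)η`. -/
theorem sum_perturb (a b : ℕ → ℝ) (η : ℝ) (n : ℕ) :
    ∑ m ∈ range n, ((b (2 * m) - 2 * η) - (a (2 * m) - η)) = (∑ m ∈ range n, (b (2 * m) - a (2 * m))) - n * η := by
  rw [Finset.sum_congr rfl fun m _ => (by ring : (b (2 * m) - 2 * η) - (a (2 * m) - η) = (b (2 * m) - a (2 * m)) - η),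
    sum_sub_distrib, sum_const, card_range, nsmul_eq_mul]

/-- **A uniform room `η`**: if the edge conditions `0 < a_j < b_j` (`j < k`) and the corner conditions of `J_k` hold at `(a₀; a | b)`,
then for some `η > 0` they hold at `(a₀ + η; a_j − η | b_j − 2η)`. -/
theorem exists_perturb {k : ℕ} (hk : 1 ≤ k) (a₀ : ℝ) (a b : ℕ → ℝ) (hE : ∀ j, j < k → 0 < a j ∧ a j < b j)
    (hA : ∀ i, 2 * i + 2 ≤ k → a₀ < (∑ m ∈ range (i + 1), (b (2 * m) - a (2 * m))) + a (2 * i + 1))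
    (hAodd : Odd k → a₀ < ∑ m ∈ range ((k + 1) / 2), (b (2 * m) - a (2 * m))) :
    ∃ η : ℝ, 0 < η ∧
      (∀ j, j < k → 0 < a j - η ∧ a j - η < b j - 2 * η) ∧
      (∀ i, 2 * i + 2 ≤ k →
        a₀ + η < (∑ m ∈ range (i + 1), ((b (2 * m) - 2 * η) - (a (2 * m) - η))) + (a (2 * i + 1) - η)) ∧
      (Odd k → a₀ + η < ∑ m ∈ range ((k + 1) / 2), ((b (2 * m) - 2 * η) - (a (2 * m) - η))) := by
  classical
  -- the finite set of (positive) gaps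
  set G : Finset ℝ := ((range k).image fun j => a j) ∪ ((range k).image fun j => b j - a j) ∪
      ((range (k / 2)).image fun i => (∑ m ∈ range (i + 1), (b (2 * m) - a (2 * m))) + a (2 * i + 1) - a₀) ∪
      (if Odd k then {(∑ m ∈ range ((k + 1) / 2), (b (2 * m) - a (2 * m))) - a₀} else ∅) with hG
  have hne : G.Nonempty := ⟨a 0, by
    rw [hG]; simp only [Finset.mem_union, Finset.mem_image, Finset.mem_range]
    exact Or.inl (Or.inl (Or.inl ⟨0, hk, rfl⟩))⟩
  have hpos : ∀ g ∈ G, 0 < g := by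
    intro g hg
    rw [hG] at hg
    simp only [Finset.mem_union, Finset.mem_image, Finset.mem_range] at hg
    rcases hg with ((⟨j, hj, rfl⟩ | ⟨j, hj, rfl⟩) | ⟨i, hi, rfl⟩) | hg
    · exact (hE j hj).1
    · linarith [(hE j hj).2]
    · have := hA i (by omega); linarith
    · split_ifs at hg with hodd
      · rw [Finset.mem_singleton] at hg; rw [hg]; linarith [hAodd hodd]
      · simp at hg
  set g : ℝ := G.min' hne with hg
  have hg0 : 0 < g := (Finset.lt_min'_iff G hne).2 hpos
  have hle : ∀ x ∈ G, g ≤ x := fun x hx => Finset.min'_le G x hx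
  refine ⟨g / (2 * ((k : ℝ) + 3)), by positivity, fun j hj => ?_, fun i hi => ?_, fun hodd => ?_⟩
  · have h1 : g ≤ a j := hle _ (by rw [hG]; simp only [Finset.mem_union, Finset.mem_image, Finset.mem_range]; exact Or.inl (Or.inl (Or.inl ⟨j, hj, rfl⟩)))
    have h2 : g ≤ b j - a j := hle _ (by rw [hG]; simp only [Finset.mem_union, Finset.mem_image, Finset.mem_range]; exact Or.inl (Or.inl (Or.inr ⟨j, hj, rfl⟩)))
    have hk0 : (0 : ℝ) < 2 * ((k : ℝ) + 3) := by positivity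
    have h3 : g / (2 * ((k : ℝ) + 3)) < g := by
      rw [div_lt_iff₀ hk0]; nlinarith
    constructor <;> linarith
  · have h1 : g ≤ (∑ m ∈ range (i + 1), (b (2 * m) - a (2 * m))) + a (2 * i + 1) - a₀ :=
      hle _ (by rw [hG]; simp only [Finset.mem_union, Finset.mem_image, Finset.mem_range]; exact Or.inl (Or.inr ⟨i, by omega, rfl⟩))
    rw [sum_perturb]
    have hik : ((i : ℝ) + 1 + 2) * (g / (2 * ((k : ℝ) + 3))) ≤ g / 2 := by
      rw [← mul_div_assoc, div_le_div_iff₀ (by positivity) (by norm_num)]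
      have : (i : ℝ) + 3 ≤ (k : ℝ) + 3 := by
        have : (i : ℝ) ≤ k := by exact_mod_cast (by omega : i ≤ k)
        linarith
      nlinarith
    push_cast
    nlinarith
  · have h1 : g ≤ (∑ m ∈ range ((k + 1) / 2), (b (2 * m) - a (2 * m))) - a₀ :=
      hle _ (by rw [hG]; simp only [Finset.mem_union, hodd, if_true, Finset.mem_singleton]; exact Or.inr trivial)
    rw [sum_perturb]
    have hck : ((((k + 1) / 2 : ℕ) : ℝ) + 1) * (g / (2 * ((k : ℝ) + 3))) ≤ g / 2 := by
      rw [← mul_div_assoc, div_le_div_iff₀ (by positivity) (by norm_num)]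
      have : (((k + 1) / 2 : ℕ) : ℝ) ≤ k := by exact_mod_cast (by omega : (k + 1) / 2 ≤ k)
      nlinarith
    nlinarith

/-- **Integrability at perturbed parameters from the corner conditions alone** (`k ≥ 1`, `a₀ ≥ 0`): there is `η > 0` with
the typed real integrand at `(a₀ + η; a_j − η | b_j − 2η)` integrable on `[0,1]^k` — the hypothesis `hJη` of
`SorokinParameterHolomorphy.hasDerivAt_line`. -/
theorem exists_integrable_perturb {k : ℕ} (hk : 1 ≤ k) {a₀ : ℝ} (ha₀ : 0 ≤ a₀) (a b : ℕ → ℝ)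
    (hE : ∀ j, j < k → 0 < a j ∧ a j < b j)
    (hA : ∀ i, 2 * i + 2 ≤ k → a₀ < (∑ m ∈ range (i + 1), (b (2 * m) - a (2 * m))) + a (2 * i + 1))
    (hAodd : Odd k → a₀ < ∑ m ∈ range ((k + 1) / 2), (b (2 * m) - a (2 * m))) :
    ∃ η : ℝ, 0 < η ∧
      IntegrableOn (sorokinIntegrand k (a₀ + η) (fun n => a n - η) (fun n => b n - 2 * η))
        (Set.pi univ fun _ : Fin k => Icc (0 : ℝ) 1) volume := by
  obtain ⟨η, hη, hE', hA', hAodd'⟩ := exists_perturb hk a₀ a b hE hA hAodd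
  exact ⟨η, hη, integrableOn_sorokinIntegrand hk (by linarith) hE' hA' hAodd'⟩

end Summit.KontsevichZagierPeriods.Zeta5Search.SorokinCornerPerturb

end
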